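import Summits.ValiantsHypothesis.ValiantsHypothesis.Theorems.PolyaContinuedMonotoneCoverHardPureFiber
import Summits.ValiantsHypothesis.ValiantsHypothesis.Theorems.PolyaContinuedMonotoneCoverHardWidthTwo

/-!
# Crux `MonotoneCoverHard` (stmt-ValiantsHypothesis-7421), width line — RUNG: **row-levelled and
column-levelled Pfaffian covers have all widths ≤ 2**, hence satisfy the crux

(val-width-7421-p4 g0, 2026-08-28; lane «width ≥ 3 at one level ⇒ non-Pfaffian».)

A levelled cover of `per_n` is ROW-LEVELLED if the row level of a used variable edge is a function of
the label-ROW of its label (`g(row e) = L k` whenever `a e = x_{k l}`), COLUMN-LEVELLED if it is a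
function of the label-column.  Every cover in the literature is of this kind: Grenet's `2^n − 1` cover
and every ABP / decision-tree cover read label-row `ℓ + 1` at level `ℓ`; Laplace-type and
`K_{2,2}`-block covers likewise.  In such a cover every fiber is pure, so `false_of_pure_fiber` gives:

* `width_le_two_of_rowLevelled`, `width_le_two_of_colLevelled` — every weight-nonzero perfect matching
  has at most TWO variable edges leaving each row level (all widths `c_ℓ ≤ 2`);
* `le_two_mul_card_of_rowLevelled` — in particular, if the variable edges leave only the row levels of a
  set `S`, then `n ≤ 2 · #S` (two variable levels ⇒ `n ≤ 4`: the TWO-LEVEL case of the lane for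
  row-levelled covers);
* `no_quasipolynomial_rowLevelled_cover`, `no_quasipolynomial_colLevelled_cover` — **the crux
  `MonotoneCoverHard` HOLDS for row-levelled and for column-levelled Pfaffian covers** (via the width-2
  rung `no_quasipolynomial_width_two_cover` of val-width-7421-p2).

So the width bet `stub_width` — and the crux — can only fail on LEVEL-MIXING covers: covers in which two
weight-nonzero perfect matchings read the same label-row (and the same label-column) at different
levels.  VP ≠ VNP is not moved; `MonotoneCoverHard` stays open.  No definitions.
-/

namespace Summit.ValiantsHypothesis.ValiantsHypothesis.Theorems.PolyaContinuedMonotoneCoverHard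

-- summit = sub-problem name (single-conjunct summit, D-0017 layout), so the namespace repeats it
set_option linter.dupNamespace false

open scoped Classical
open Finset
open Literature.Computability.AlgebraicComplexity (perPoly)
open Summit.ValiantsHypothesis.ValiantsHypothesis.Theorems.PolyaContinued.MonotoneCoverHardRectangle
  (exists_labels aeval_permanent_cover perPoly_eq_sum_monomial label_bijection pexp_injective)

/-- **Row-levelled ⇒ every width is `≤ 2`.**  In a cover of `per_n` with Pfaffian `E` and a level
function `g` on its used edges, if the row level of every used variable edge is `L` of its label-row,
then every weight-nonzero perfect matching has at most two variable edges leaving each row level. -/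
theorem width_le_two_of_rowLevelled (n m : ℕ) (E : Finset (Fin m × Fin m))
    (a : Fin m × Fin m → MvPolynomial (Fin n × Fin n) ℂ)
    (hsig : ∃ s : Fin m × Fin m → ℂ, (∀ e, s e = 1 ∨ s e = -1) ∧
      (Matrix.of fun i j => if (i, j) ∈ E then MvPolynomial.C (s (i, j)) * MvPolynomial.X (i, j)
          else 0 : Matrix (Fin m) (Fin m) (MvPolynomial (Fin m × Fin m) ℂ)).det =
        (Matrix.of fun i j => if (i, j) ∈ E then MvPolynomial.X (i, j) else 0 :
          Matrix (Fin m) (Fin m) (MvPolynomial (Fin m × Fin m) ℂ)).permanent)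
    (ha : ∀ e, (∃ j, a e = MvPolynomial.X j) ∨ a e = 0 ∨ a e = 1)
    (hper : perPoly (Fin n) ℂ =
      MvPolynomial.aeval a (Matrix.of fun i j => if (i, j) ∈ E then MvPolynomial.X (i, j) else 0 :
          Matrix (Fin m) (Fin m) (MvPolynomial (Fin m × Fin m) ℂ)).permanent)
    (g : Fin m ⊕ Fin m → ℕ)
    (hg : ∀ τ : Equiv.Perm (Fin m), (∀ i, (i, τ i) ∈ E ∧ a (i, τ i) ≠ 0) → ∀ i,
      ((∃ k, a (i, τ i) = MvPolynomial.X k) → g (Sum.inr (τ i)) = g (Sum.inl i) + 1) ∧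
      ((¬ ∃ k, a (i, τ i) = MvPolynomial.X k) → g (Sum.inr (τ i)) = g (Sum.inl i)))
    (L : Fin n → ℕ)
    (hL : ∀ τ : Equiv.Perm (Fin m), (∀ i, (i, τ i) ∈ E ∧ a (i, τ i) ≠ 0) →
      ∀ i (v : Fin n × Fin n), a (i, τ i) = MvPolynomial.X v → g (Sum.inl i) = L v.1)
    (τ : Equiv.Perm (Fin m)) (hτ : ∀ i, (i, τ i) ∈ E ∧ a (i, τ i) ≠ 0) (ℓ : ℕ) :
    (univ.filter fun i : Fin m =>
      (∃ k, a (i, τ i) = MvPolynomial.X k) ∧ g (Sum.inl i) = ℓ).card ≤ 2 := by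
  by_contra h3
  rw [not_le] at h3
  obtain ⟨σ₀, hσ₀, huniq⟩ := exists_perm_labels E a ha hper τ hτ
  set K : Finset (Fin n) := univ.filter fun k => L k = ℓ with hKdef
  -- the label-row map is an injection of the level-`ℓ` variable rows into `K`
  have hlab : ∀ i, (∃ k, a (i, τ i) = MvPolynomial.X k) →
      ∃ k : Fin n, a (i, τ i) = MvPolynomial.X (k, σ₀ k) := by
    rintro i ⟨v, hv⟩
    exact ⟨v.1, by rw [hv, hσ₀ i v hv]⟩
  -- `Fin n` is nonempty: some row carries a variable label
  obtain ⟨i₁, hi₁⟩ : (univ.filter fun i : Fin m =>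
      (∃ k, a (i, τ i) = MvPolynomial.X k) ∧ g (Sum.inl i) = ℓ).Nonempty := by
    rw [← Finset.card_pos]; omega
  obtain ⟨⟨v₁, -⟩, -⟩ := (Finset.mem_filter.1 hi₁).2
  haveI : Nonempty (Fin n) := ⟨v₁.1⟩
  choose! kr hkr using hlab
  have hK3 : 3 ≤ K.card := by
    refine le_trans h3 (Finset.card_le_card_of_injOn kr ?_ ?_)
    · intro i hi
      have hi' := (Finset.mem_filter.1 (Finset.mem_coe.1 hi)).2
      have h1 := hkr i hi'.1
      have h2 := hL τ hτ i _ h1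
      refine Finset.mem_coe.2 (Finset.mem_filter.2 ⟨Finset.mem_univ _, ?_⟩)
      rw [← h2, hi'.2]
    · intro i hi j hj hij
      have hi' := (Finset.mem_filter.1 (Finset.mem_coe.1 hi)).2
      have hj' := (Finset.mem_filter.1 (Finset.mem_coe.1 hj)).2
      obtain ⟨i₀, -, hi₀⟩ := huniq (kr i)
      have h1 := hi₀ i (hkr i hi'.1)
      have h2 := hi₀ j (by rw [hij]; exact hkr j hj'.1)
      rw [h1, h2]
  refine false_of_pure_fiber n m E a hsig ha hper g hg τ hτ σ₀ hσ₀ ℓ K hK3 ?_ ?_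
  · intro i k hk
    rw [hKdef, Finset.mem_filter, ← hL τ hτ i _ hk]
    simp
  · intro τ' hτ' _ i j hj hjK
    rw [hKdef, Finset.mem_filter] at hjK
    rw [hL τ' hτ' i j hj, hjK.2]

/-- **Column-levelled ⇒ every width is `≤ 2`.**  Same as `width_le_two_of_rowLevelled` with the row
level of a used variable edge a function `L` of its label-COLUMN. -/
theorem width_le_two_of_colLevelled (n m : ℕ) (E : Finset (Fin m × Fin m))
    (a : Fin m × Fin m → MvPolynomial (Fin n × Fin n) ℂ)
    (hsig : ∃ s : Fin m × Fin m → ℂ, (∀ e, s e = 1 ∨ s e = -1) ∧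
      (Matrix.of fun i j => if (i, j) ∈ E then MvPolynomial.C (s (i, j)) * MvPolynomial.X (i, j)
          else 0 : Matrix (Fin m) (Fin m) (MvPolynomial (Fin m × Fin m) ℂ)).det =
        (Matrix.of fun i j => if (i, j) ∈ E then MvPolynomial.X (i, j) else 0 :
          Matrix (Fin m) (Fin m) (MvPolynomial (Fin m × Fin m) ℂ)).permanent)
    (ha : ∀ e, (∃ j, a e = MvPolynomial.X j) ∨ a e = 0 ∨ a e = 1)
    (hper : perPoly (Fin n) ℂ =
      MvPolynomial.aeval a (Matrix.of fun i j => if (i, j) ∈ E then MvPolynomial.X (i, j) else 0 :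
          Matrix (Fin m) (Fin m) (MvPolynomial (Fin m × Fin m) ℂ)).permanent)
    (g : Fin m ⊕ Fin m → ℕ)
    (hg : ∀ τ : Equiv.Perm (Fin m), (∀ i, (i, τ i) ∈ E ∧ a (i, τ i) ≠ 0) → ∀ i,
      ((∃ k, a (i, τ i) = MvPolynomial.X k) → g (Sum.inr (τ i)) = g (Sum.inl i) + 1) ∧
      ((¬ ∃ k, a (i, τ i) = MvPolynomial.X k) → g (Sum.inr (τ i)) = g (Sum.inl i)))
    (L : Fin n → ℕ)
    (hL : ∀ τ : Equiv.Perm (Fin m), (∀ i, (i, τ i) ∈ E ∧ a (i, τ i) ≠ 0) →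
      ∀ i (v : Fin n × Fin n), a (i, τ i) = MvPolynomial.X v → g (Sum.inl i) = L v.2)
    (τ : Equiv.Perm (Fin m)) (hτ : ∀ i, (i, τ i) ∈ E ∧ a (i, τ i) ≠ 0) (ℓ : ℕ) :
    (univ.filter fun i : Fin m =>
      (∃ k, a (i, τ i) = MvPolynomial.X k) ∧ g (Sum.inl i) = ℓ).card ≤ 2 := by
  by_contra h3
  rw [not_le] at h3
  obtain ⟨σ₀, hσ₀, huniq⟩ := exists_perm_labels E a ha hper τ hτ
  set K : Finset (Fin n) := univ.filter fun k => L (σ₀ k) = ℓ with hKdef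
  have hlab : ∀ i, (∃ k, a (i, τ i) = MvPolynomial.X k) →
      ∃ k : Fin n, a (i, τ i) = MvPolynomial.X (k, σ₀ k) := by
    rintro i ⟨v, hv⟩
    exact ⟨v.1, by rw [hv, hσ₀ i v hv]⟩
  -- `Fin n` is nonempty: some row carries a variable label
  obtain ⟨i₁, hi₁⟩ : (univ.filter fun i : Fin m =>
      (∃ k, a (i, τ i) = MvPolynomial.X k) ∧ g (Sum.inl i) = ℓ).Nonempty := by
    rw [← Finset.card_pos]; omega
  obtain ⟨⟨v₁, -⟩, -⟩ := (Finset.mem_filter.1 hi₁).2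
  haveI : Nonempty (Fin n) := ⟨v₁.1⟩
  choose! kr hkr using hlab
  have hK3 : 3 ≤ K.card := by
    refine le_trans h3 (Finset.card_le_card_of_injOn kr ?_ ?_)
    · intro i hi
      have hi' := (Finset.mem_filter.1 (Finset.mem_coe.1 hi)).2
      have h1 := hkr i hi'.1
      have h2 := hL τ hτ i _ h1
      refine Finset.mem_coe.2 (Finset.mem_filter.2 ⟨Finset.mem_univ _, ?_⟩)
      rw [← h2, hi'.2]
    · intro i hi j hj hij
      have hi' := (Finset.mem_filter.1 (Finset.mem_coe.1 hi)).2
      have hj' := (Finset.mem_filter.1 (Finset.mem_coe.1 hj)).2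
      obtain ⟨i₀, -, hi₀⟩ := huniq (kr i)
      have h1 := hi₀ i (hkr i hi'.1)
      have h2 := hi₀ j (by rw [hij]; exact hkr j hj'.1)
      rw [h1, h2]
  refine false_of_pure_fiber n m E a hsig ha hper g hg τ hτ σ₀ hσ₀ ℓ K hK3 ?_ ?_
  · intro i k hk
    rw [hKdef, Finset.mem_filter, ← hL τ hτ i _ hk]
    simp
  · -- purity: a matching carrying `x_{k σ₀ k}` for all `k ∉ K` maps `K` onto `σ₀ K`
    intro τ' hτ' hagree i j hj hjK
    obtain ⟨σ', hσ', huniq'⟩ := exists_perm_labels E a ha hper τ' hτ'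
    have hoff : ∀ k, k ∉ K → σ' k = σ₀ k := by
      intro k hk
      obtain ⟨i', hi'⟩ := hagree k hk
      exact hσ' i' _ hi'
    have hj2 : σ' j.1 = j.2 := hσ' i j hj
    -- `σ₀⁻¹ (σ' j.1)` lies in `K`
    have hin : σ₀.symm j.2 ∈ K := by
      by_contra hk
      have h1 := hoff _ hk
      rw [Equiv.apply_symm_apply] at h1
      have h2 : σ₀.symm j.2 = j.1 := σ'.injective (h1.trans hj2.symm)
      rw [h2] at hk
      exact hk hjK
    rw [hKdef, Finset.mem_filter, Equiv.apply_symm_apply] at hin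
    rw [hL τ' hτ' i j hj, hin.2]

/-- **Row-levelled with variable levels in `S` ⇒ `n ≤ 2 · #S`.**  In particular a row-levelled
label-bijective Pfaffian cover with only two variable levels has `n ≤ 4` (the two-level case of the
lane «width ≥ 3 at one level ⇒ non-Pfaffian» for row-levelled covers). -/
theorem le_two_mul_card_of_rowLevelled (n m : ℕ) (E : Finset (Fin m × Fin m))
    (a : Fin m × Fin m → MvPolynomial (Fin n × Fin n) ℂ)
    (hsig : ∃ s : Fin m × Fin m → ℂ, (∀ e, s e = 1 ∨ s e = -1) ∧
      (Matrix.of fun i j => if (i, j) ∈ E then MvPolynomial.C (s (i, j)) * MvPolynomial.X (i, j)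
          else 0 : Matrix (Fin m) (Fin m) (MvPolynomial (Fin m × Fin m) ℂ)).det =
        (Matrix.of fun i j => if (i, j) ∈ E then MvPolynomial.X (i, j) else 0 :
          Matrix (Fin m) (Fin m) (MvPolynomial (Fin m × Fin m) ℂ)).permanent)
    (ha : ∀ e, (∃ j, a e = MvPolynomial.X j) ∨ a e = 0 ∨ a e = 1)
    (hper : perPoly (Fin n) ℂ =
      MvPolynomial.aeval a (Matrix.of fun i j => if (i, j) ∈ E then MvPolynomial.X (i, j) else 0 :
          Matrix (Fin m) (Fin m) (MvPolynomial (Fin m × Fin m) ℂ)).permanent)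
    (g : Fin m ⊕ Fin m → ℕ)
    (hg : ∀ τ : Equiv.Perm (Fin m), (∀ i, (i, τ i) ∈ E ∧ a (i, τ i) ≠ 0) → ∀ i,
      ((∃ k, a (i, τ i) = MvPolynomial.X k) → g (Sum.inr (τ i)) = g (Sum.inl i) + 1) ∧
      ((¬ ∃ k, a (i, τ i) = MvPolynomial.X k) → g (Sum.inr (τ i)) = g (Sum.inl i)))
    (L : Fin n → ℕ)
    (hL : ∀ τ : Equiv.Perm (Fin m), (∀ i, (i, τ i) ∈ E ∧ a (i, τ i) ≠ 0) →
      ∀ i (v : Fin n × Fin n), a (i, τ i) = MvPolynomial.X v → g (Sum.inl i) = L v.1)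
    (S : Finset ℕ)
    (hS : ∀ τ : Equiv.Perm (Fin m), (∀ i, (i, τ i) ∈ E ∧ a (i, τ i) ≠ 0) → ∀ i,
      (∃ k, a (i, τ i) = MvPolynomial.X k) → g (Sum.inl i) ∈ S) :
    n ≤ 2 * S.card := by
  -- a weight-nonzero perfect matching exists (the cover realises the identity permutation)
  obtain ⟨δ, hδ, -, -⟩ := exists_labels a ha
  set G := Finset.univ.filter fun τ : Equiv.Perm (Fin m) => ∀ i, (i, τ i) ∈ E ∧ a (i, τ i) ≠ 0
    with hG
  have hsum : ∑ τ ∈ G, MvPolynomial.monomial (∑ i, δ (i, τ i)) (1 : ℂ) =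
      ∑ σ : Equiv.Perm (Fin n), MvPolynomial.monomial (∑ k, Finsupp.single (k, σ k) 1) (1 : ℂ) := by
    rw [← aeval_permanent_cover E a δ hδ G hG, ← hper, perPoly_eq_sum_monomial]
  obtain ⟨-, -, hsurj⟩ := label_bijection G (fun τ => ∑ i, δ (i, τ i))
    (fun σ : Equiv.Perm (Fin n) => ∑ k, Finsupp.single (k, σ k) (1 : ℕ)) pexp_injective hsum
  obtain ⟨τ₀, hτ₀G, -⟩ := hsurj 1
  have hτ₀ : ∀ i, (i, τ₀ i) ∈ E ∧ a (i, τ₀ i) ≠ 0 := by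
    rw [hG] at hτ₀G; exact (Finset.mem_filter.1 hτ₀G).2
  -- the variable rows of `τ₀` split by level into the levels of `S`, each part of size `≤ 2`
  have htot := card_var_eq E a ha hper τ₀ hτ₀
  have hsplit : (univ.filter fun i : Fin m => ∃ k, a (i, τ₀ i) = MvPolynomial.X k) =
      S.biUnion fun ℓ => univ.filter fun i : Fin m =>
        (∃ k, a (i, τ₀ i) = MvPolynomial.X k) ∧ g (Sum.inl i) = ℓ := by
    ext i
    simp only [Finset.mem_filter, Finset.mem_univ, true_and, Finset.mem_biUnion]
    constructor
    · intro hv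
      exact ⟨g (Sum.inl i), hS τ₀ hτ₀ i hv, hv, rfl⟩
    · rintro ⟨ℓ, -, hv, -⟩
      exact hv
  rw [← htot, hsplit]
  refine le_trans Finset.card_biUnion_le ?_
  calc ∑ ℓ ∈ S, (univ.filter fun i : Fin m =>
          (∃ k, a (i, τ₀ i) = MvPolynomial.X k) ∧ g (Sum.inl i) = ℓ).card
      ≤ ∑ ℓ ∈ S, 2 := Finset.sum_le_sum fun ℓ _ =>
          width_le_two_of_rowLevelled n m E a hsig ha hper g hg L hL τ₀ hτ₀ ℓ
    _ = 2 * S.card := by rw [Finset.sum_const, smul_eq_mul, mul_comm]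

/-- **The crux HOLDS for row-levelled Pfaffian covers**: there is no quasi-polynomial family of
label-bijective Pfaffian covers of the permanent that are levelled with the row level of every variable
edge a function of its label-row.  (`MonotoneCoverHard` with the conjunct "∃ level function `g` and
`L : Fin n → ℕ` with `g(row e) = L k` whenever `a e = x_{k l}`" added inside the purported family.) -/
theorem no_quasipolynomial_rowLevelled_cover :
    ¬ ∃ c : ℕ, ∀ n : ℕ, ∃ m : ℕ, m ≤ 2 ^ ((Nat.log 2 n + c) ^ c) ∧
      ∃ (E : Finset (Fin m × Fin m)) (a : Fin m × Fin m → MvPolynomial (Fin n × Fin n) ℂ),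
        (∃ s : Fin m × Fin m → ℂ, (∀ e, s e = 1 ∨ s e = -1) ∧
          (Matrix.of fun i j => if (i, j) ∈ E then MvPolynomial.C (s (i, j)) * MvPolynomial.X (i, j)
              else 0 : Matrix (Fin m) (Fin m) (MvPolynomial (Fin m × Fin m) ℂ)).det =
            (Matrix.of fun i j => if (i, j) ∈ E then MvPolynomial.X (i, j) else 0 :
              Matrix (Fin m) (Fin m) (MvPolynomial (Fin m × Fin m) ℂ)).permanent) ∧
        (∀ e, (∃ j, a e = MvPolynomial.X j) ∨ a e = 0 ∨ a e = 1) ∧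
        perPoly (Fin n) ℂ =
          MvPolynomial.aeval a (Matrix.of fun i j => if (i, j) ∈ E then MvPolynomial.X (i, j) else 0 :
              Matrix (Fin m) (Fin m) (MvPolynomial (Fin m × Fin m) ℂ)).permanent ∧
        ∃ g : Fin m ⊕ Fin m → ℕ,
          (∀ i j, (i, j) ∈ E → (∃ k, a (i, j) = MvPolynomial.X k) →
            g (Sum.inr j) = g (Sum.inl i) + 1) ∧
          (∀ i j, (i, j) ∈ E → a (i, j) ≠ 0 → (¬ ∃ k, a (i, j) = MvPolynomial.X k) →
            g (Sum.inr j) = g (Sum.inl i)) ∧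
          ∃ L : Fin n → ℕ, ∀ i j, (i, j) ∈ E → ∀ v : Fin n × Fin n,
            a (i, j) = MvPolynomial.X v → g (Sum.inl i) = L v.1 := by
  rintro ⟨c, hc⟩
  apply no_quasipolynomial_width_two_cover
  refine ⟨c, fun n => ?_⟩
  obtain ⟨m, hm, E, a, hsig, ha, hper, g, hvar, hone, L, hL⟩ := hc n
  refine ⟨m, hm, E, a, hsig, ha, hper, g, hvar, hone, fun τ hτ ℓ => ?_⟩
  exact width_le_two_of_rowLevelled n m E a hsig ha hper g
    (fun τ hτ i => ⟨fun hv => hvar i (τ i) (hτ i).1 hv, fun hv => hone i (τ i) (hτ i).1 (hτ i).2 hv⟩)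
    L (fun τ hτ i v hv => hL i (τ i) (hτ i).1 v hv) τ hτ ℓ

/-- **The crux HOLDS for column-levelled Pfaffian covers** (row level of every variable edge a
function of its label-column). -/
theorem no_quasipolynomial_colLevelled_cover :
    ¬ ∃ c : ℕ, ∀ n : ℕ, ∃ m : ℕ, m ≤ 2 ^ ((Nat.log 2 n + c) ^ c) ∧
      ∃ (E : Finset (Fin m × Fin m)) (a : Fin m × Fin m → MvPolynomial (Fin n × Fin n) ℂ),
        (∃ s : Fin m × Fin m → ℂ, (∀ e, s e = 1 ∨ s e = -1) ∧
          (Matrix.of fun i j => if (i, j) ∈ E then MvPolynomial.C (s (i, j)) * MvPolynomial.X (i, j)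
              else 0 : Matrix (Fin m) (Fin m) (MvPolynomial (Fin m × Fin m) ℂ)).det =
            (Matrix.of fun i j => if (i, j) ∈ E then MvPolynomial.X (i, j) else 0 :
              Matrix (Fin m) (Fin m) (MvPolynomial (Fin m × Fin m) ℂ)).permanent) ∧
        (∀ e, (∃ j, a e = MvPolynomial.X j) ∨ a e = 0 ∨ a e = 1) ∧
        perPoly (Fin n) ℂ =
          MvPolynomial.aeval a (Matrix.of fun i j => if (i, j) ∈ E then MvPolynomial.X (i, j) else 0 :
              Matrix (Fin m) (Fin m) (MvPolynomial (Fin m × Fin m) ℂ)).permanent ∧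
        ∃ g : Fin m ⊕ Fin m → ℕ,
          (∀ i j, (i, j) ∈ E → (∃ k, a (i, j) = MvPolynomial.X k) →
            g (Sum.inr j) = g (Sum.inl i) + 1) ∧
          (∀ i j, (i, j) ∈ E → a (i, j) ≠ 0 → (¬ ∃ k, a (i, j) = MvPolynomial.X k) →
            g (Sum.inr j) = g (Sum.inl i)) ∧
          ∃ L : Fin n → ℕ, ∀ i j, (i, j) ∈ E → ∀ v : Fin n × Fin n,
            a (i, j) = MvPolynomial.X v → g (Sum.inl i) = L v.2 := by
  rintro ⟨c, hc⟩
  apply no_quasipolynomial_width_two_cover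
  refine ⟨c, fun n => ?_⟩
  obtain ⟨m, hm, E, a, hsig, ha, hper, g, hvar, hone, L, hL⟩ := hc n
  refine ⟨m, hm, E, a, hsig, ha, hper, g, hvar, hone, fun τ hτ ℓ => ?_⟩
  exact width_le_two_of_colLevelled n m E a hsig ha hper g
    (fun τ hτ i => ⟨fun hv => hvar i (τ i) (hτ i).1 hv, fun hv => hone i (τ i) (hτ i).1 (hτ i).2 hv⟩)
    L (fun τ hτ i v hv => hL i (τ i) (hτ i).1 v hv) τ hτ ℓ

end Summit.ValiantsHypothesis.ValiantsHypothesis.Theorems.PolyaContinuedMonotoneCoverHard
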